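import Literature.Analysis.Pluripotential.MongeAmpereMassInvariance
import Literature.Analysis.Pluripotential.FubiniStudyMongeAmpereMass
import HarnessLib

/-!
# The total Monge–Ampère masses of all orders of `κ · ½log(1+|w|²) + ψ`, `ψ ∈ C_c^∞(ℂᴺ)`

Topic `Literature/Analysis/Pluripotential`; step (P7a) of the proof of the named fact
`BoucksomEtAl2010_regularMass_le_degree_pow` (`NonPluripolarMongeAmpereMass.lean`). For the
densities `heightDensity j u` of `(dd^c u)ʲ ∧ ω_FS^{N-j}` on the chart `ℂᴺ` of `ℙᴺ`
(`BiextensionHeightPackage.lean`: `N!(2/π)ᴺ/C(N,j) · Re [sʲ] det(s·Levi u + Levi fs)`), and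
`u = κ · fs + ψ` with `fs = ½ log(1+|w|²)`, `ψ : ℂᴺ → ℝ` smooth with compact support:

  **`∫_{ℂᴺ} heightDensity j (κ fs + ψ) dλ = κʲ`** for every `j ≤ N`
  (`integral_heightDensity_smul_fsPotential_add`, with integrability),

the cohomological value `{κω}ʲ·{ω}^{N-j}` of BEGZ, Prop. 1.20 in the Kähler case, here for SMOOTH
potentials equal to `κ fs` near infinity. Ingredients:

* `det_add_smul_eq_sum_coeff` — `det(A + tG) = Σ_{j ≤ N} [sʲ]det(sA + G) · t^{N-j}` (`t ≠ 0`);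
  `coeff_det_X_smul_add_eq` — the coefficients as polynomials in the entries (continuity);
  `eq_of_sum_mul_pow_eq` — coefficients are determined by `N + 1` values (a polynomial of degree
  `≤ N` with `N + 1` roots vanishes);
* `leviMatrix_const_smul`, `leviMatrix_add_const`; `coeff_pencil_of_notMem_tsupport`
  (off `tsupport ψ` the `j`-th coefficient is `C(N,j) κʲ det Levi fs`), `integrable_coeff_pencil`;
* `integral_det_pencil_value` — `∫ det(Levi(κ fs + ψ) + t Levi fs) = (κ+t)ᴺ ∫ det Levi fs`, from the
  perturbation invariance `integral_det_leviMatrix_add_sub` (`MongeAmpereMassInvariance.lean`)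
  applied to `(κ + t) fs`; `integral_coeff_pencil` — the `t`-trick: comparing the two polynomial
  identities in `t` coefficientwise, `∫ [sʲ]det(⋯) = C(N,j) κʲ ∫ det Levi fs`;
* `integrable_det_leviMatrix_fsPotential`, `integral_heightDensity_fsPotential` (`= 1`, from
  `lintegral_heightDensity_fsPotential` of `FubiniStudyMongeAmpereMass.lean`),
  `factorial_mul_re_integral_det_leviMatrix_fsPotential` (`N!(2/π)ᴺ Re ∫ det Levi fs = 1`);
* `heightDensity_add_const` — constants do not change the densities.

## References

* [BoucksomEtAl2010] Boucksom–Eyssidieux–Guedj–Zeriahi, Acta Math. 205 (2010), proof of Prop. 1.6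
  and Prop. 1.20 (the masses are "computed in cohomology"); here the smooth compactly-perturbed
  case, proved from scratch. Tagged folklore.
-/

noncomputable section

open scoped Topology ComplexConjugate ContDiff Matrix Polynomial
open Filter Set Complex MeasureTheory Polynomial Matrix
open Literature.AlgebraicGeometry.HodgeTheory.BiextensionHeight (leviMatrix heightDensity
  fsPotential)

namespace Literature.Analysis.Pluripotential

/-- Local notation for the pencil polynomial `det (s · Levi u (w) + Levi fs (w)) ∈ ℂ[s]` whose
coefficients define `heightDensity`. -/
local notation3 "pencil(" u ", " w ")" =>
  Matrix.det ((X : ℂ[X]) • (leviMatrix u w).map C + (leviMatrix fsPotential w).map C)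

section PencilAlgebra

variable {N : ℕ}

/-- **Values of the pencil determinant through the coefficients of `det (s A + G)`**: for `t ≠ 0`,
`det (A + t G) = Σ_{j ≤ N} [sʲ] det(s A + G) · t^{N-j}`. [folklore] -/
theorem det_add_smul_eq_sum_coeff (A G : Matrix (Fin N) (Fin N) ℂ) {t : ℂ} (ht : t ≠ 0) :
    (A + t • G).det = ∑ j ∈ Finset.range (N + 1),
      (Matrix.det ((X : ℂ[X]) • A.map C + G.map C)).coeff j * t ^ (N - j) := by
  set Q : ℂ[X] := Matrix.det ((X : ℂ[X]) • A.map C + G.map C) with hQ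
  -- `det (A + t G) = tᴺ det (t⁻¹ A + G) = tᴺ Q(t⁻¹)`
  have h1 : A + t • G = t • (t⁻¹ • A + G) := by
    rw [smul_add, smul_smul, mul_inv_cancel₀ ht, one_smul]
  have h2 : (t⁻¹ • A + G).det = Q.eval t⁻¹ := by
    rw [hQ, ← Polynomial.coe_evalRingHom, RingHom.map_det]
    congr 1
    ext i j
    simp only [Matrix.add_apply, Matrix.smul_apply, Matrix.map_apply, RingHom.mapMatrix_apply,
      smul_eq_mul, Polynomial.coe_evalRingHom, Polynomial.eval_add, Polynomial.eval_mul,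
      Polynomial.eval_X, Polynomial.eval_C]
  have hdeg : Q.natDegree < N + 1 := by
    have h := Polynomial.natDegree_det_X_add_C_le A G
    rw [Fintype.card_fin] at h
    exact Nat.lt_succ_of_le h
  rw [h1, Matrix.det_smul, Fintype.card_fin, h2, Polynomial.eval_eq_sum_range' hdeg,
    Finset.mul_sum]
  refine Finset.sum_congr rfl fun j hj ↦ ?_
  have hjN : j ≤ N := Nat.lt_succ_iff.mp (Finset.mem_range.mp hj)
  have hsplit : t ^ N = t ^ (N - j) * t ^ j := by rw [← pow_add, Nat.sub_add_cancel hjN]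
  have htj : t ^ j ≠ 0 := pow_ne_zero _ ht
  rw [hsplit, inv_pow]
  field_simp

/-- **Uniqueness of the coefficients from `N + 1` values**: if two coefficient families give the
same values `Σ_{j ≤ N} c_j tᵢ^{N-j}` at `N + 1` distinct points, they agree. [folklore] -/
theorem eq_of_sum_mul_pow_eq {ι : Type*} [Fintype ι] (t : ι → ℂ) (ht : Function.Injective t)
    (hcard : N < Fintype.card ι) (c c' : ℕ → ℂ)
    (h : ∀ i, ∑ j ∈ Finset.range (N + 1), c j * t i ^ (N - j) =
      ∑ j ∈ Finset.range (N + 1), c' j * t i ^ (N - j)) {j : ℕ} (hj : j ≤ N) :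
    c j = c' j := by
  set p : ℂ[X] := ∑ j ∈ Finset.range (N + 1), C (c j - c' j) * X ^ (N - j) with hp
  have hdeg : p.natDegree ≤ N := by
    refine (Polynomial.natDegree_sum_le _ _).trans (Finset.sup_le fun j _ ↦ ?_)
    exact (Polynomial.natDegree_C_mul_X_pow_le _ _).trans (Nat.sub_le N j)
  have heval : ∀ i, p.eval (t i) = 0 := by
    intro i
    simp only [hp, Polynomial.eval_finsetSum, Polynomial.eval_mul, Polynomial.eval_C,
      Polynomial.eval_pow, Polynomial.eval_X, sub_mul, Finset.sum_sub_distrib, h i, sub_self]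
  have hp0 : p = 0 :=
    Polynomial.eq_zero_of_natDegree_lt_card_of_eval_eq_zero p ht heval (hdeg.trans_lt hcard)
  have hcoeff : p.coeff (N - j) = c j - c' j := by
    simp only [hp, Polynomial.finsetSum_coeff, Polynomial.coeff_C_mul_X_pow]
    rw [Finset.sum_eq_single j]
    · simp
    · intro k hk hkj
      have hkN : k ≤ N := Nat.lt_succ_iff.mp (Finset.mem_range.mp hk)
      rw [if_neg]
      omega
    · intro hjm
      exact absurd (Finset.mem_range.mpr (Nat.lt_succ_of_le hj)) hjm
  rw [hp0, Polynomial.coeff_zero] at hcoeff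
  exact (sub_eq_zero.mp hcoeff.symm)

/-- **The coefficients of `det (s A + G)` as polynomials in the entries**:
`[sʲ] det(s A + G) = Σ_σ sign σ Σ_{|S| = j} Π_{i ∈ S} A_{σ(i) i} Π_{i ∉ S} G_{σ(i) i}`.
[folklore] -/
theorem coeff_det_X_smul_add_eq (A G : Matrix (Fin N) (Fin N) ℂ) (j : ℕ) :
    (Matrix.det ((X : ℂ[X]) • A.map C + G.map C)).coeff j =
      ∑ σ : Equiv.Perm (Fin N), ((Equiv.Perm.sign σ : ℤ) : ℂ) *
        ∑ S ∈ (Finset.univ : Finset (Fin N)).powerset with S.card = j,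
          (∏ i ∈ S, A (σ i) i) * ∏ i ∈ Finset.univ \ S, G (σ i) i := by
  rw [Matrix.det_apply', Polynomial.finsetSum_coeff]
  refine Finset.sum_congr rfl fun σ _ ↦ ?_
  have hprod : ∏ i, ((X : ℂ[X]) • A.map C + G.map C) (σ i) i =
      ∑ S ∈ (Finset.univ : Finset (Fin N)).powerset,
        C ((∏ i ∈ S, A (σ i) i) * ∏ i ∈ Finset.univ \ S, G (σ i) i) *
          X ^ S.card := by
    have : ∀ i, ((X : ℂ[X]) • A.map C + G.map C) (σ i) i = X * C (A (σ i) i) + C (G (σ i) i) := by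
      intro i; simp [Matrix.map_apply]
    simp only [this]
    rw [Finset.prod_add]
    refine Finset.sum_congr rfl fun S _ ↦ ?_
    rw [Finset.prod_mul_distrib, Finset.prod_const, map_mul, map_prod, map_prod]
    ring
  rw [show ((Equiv.Perm.sign σ : ℤ) : ℂ[X]) = C ((Equiv.Perm.sign σ : ℤ) : ℂ) by simp,
    hprod, Polynomial.coeff_C_mul, Polynomial.finsetSum_coeff]
  congr 1
  rw [Finset.sum_filter]
  refine Finset.sum_congr rfl fun S _ ↦ ?_
  rw [Polynomial.coeff_C_mul_X_pow]
  by_cases h : S.card = j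
  · simp [h]
  · simp [h, Ne.symm h]

end PencilAlgebra

section LeviScaling

variable {N : ℕ}

/-- `Levi(a u) = a Levi(u)` for smooth `u`. [folklore] -/
theorem leviMatrix_const_smul {u : (Fin N → ℂ) → ℝ} (hu : ContDiff ℝ ∞ u) (a : ℝ) (w : Fin N → ℂ) :
    leviMatrix (a • u) w = (a : ℂ) • leviMatrix u w := by
  have h2 : ContDiff ℝ 2 u := hu.of_le (WithTop.coe_le_coe.mpr le_top)
  ext p q
  simp only [leviMatrix, Matrix.smul_apply, iteratedFDeriv_const_smul_apply h2.contDiffAt,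
    smul_eq_mul]
  simp only [_root_.smul_apply, smul_eq_mul]
  push_cast
  ring

/-- `Levi(u + const) = Levi(u)`. [folklore] -/
theorem leviMatrix_add_const {u : (Fin N → ℂ) → ℝ} (hu : ContDiff ℝ ∞ u) (a : ℝ) (w : Fin N → ℂ) :
    leviMatrix (fun w ↦ u w + a) w = leviMatrix u w := by
  have h2 : ContDiff ℝ 2 u := hu.of_le (WithTop.coe_le_coe.mpr le_top)
  have key : iteratedFDeriv ℝ 2 (fun w ↦ u w + a) w = iteratedFDeriv ℝ 2 u w := by
    rw [show (fun w ↦ u w + a) = u + fun _ ↦ a from rfl,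
      iteratedFDeriv_add_apply h2.contDiffAt contDiffAt_const,
      iteratedFDeriv_const_of_ne (by norm_num)]
    simp
  ext p q
  simp only [leviMatrix, key]

end LeviScaling


section AllOrders

variable {N : ℕ}

/-- `heightDensity` through the pencil polynomial `P_u(w) = det (s · Levi u (w) + Levi fs (w))`
(definitional unfolding). [folklore] -/
theorem heightDensity_eq_coeff_pencil (j : ℕ) (u : (Fin N → ℂ) → ℝ) (w : Fin N → ℂ) :
    heightDensity j u w = (N.factorial : ℝ) * (2 / Real.pi) ^ N / (N.choose j : ℝ) *
      ((pencil(u, w)).coeff j).re :=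
  rfl

/-- The coefficients of the pencil polynomial are continuous in `w` (`u` smooth). [folklore] -/
theorem continuous_coeff_pencil {u : (Fin N → ℂ) → ℝ} (hu : ContDiff ℝ ∞ u) (j : ℕ) :
    Continuous fun w ↦ (pencil(u, w)).coeff j := by
  simp only [coeff_det_X_smul_add_eq]
  refine continuous_finsetSum _ fun σ _ ↦ continuous_const.mul
    (continuous_finsetSum _ fun S _ ↦ (continuous_finsetProd _ fun i _ ↦ ?_).mul
      (continuous_finsetProd _ fun i _ ↦ ?_))
  · exact continuous_leviMatrix_apply hu _ _
  · exact continuous_leviMatrix_apply contDiff_fsPotential _ _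

/-- The pencil polynomial of `κ fs` off the support: `P_{κ fs + ψ}(w) = (κ s + 1)ᴺ det Levi fs (w)`
for `w ∉ tsupport ψ`, so its `j`-th coefficient is `C(N,j) κʲ det Levi fs (w)`. [folklore] -/
theorem coeff_pencil_of_notMem_tsupport {κ : ℝ} {ψ : (Fin N → ℂ) → ℝ} (hψ : ContDiff ℝ ∞ ψ)
    {w : Fin N → ℂ} (hw : w ∉ tsupport ψ) (j : ℕ) :
    (pencil(κ • fsPotential + ψ, w)).coeff j =
      (N.choose j : ℂ) * (κ : ℂ) ^ j * (leviMatrix fsPotential w).det := by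
  have hL : leviMatrix (κ • fsPotential + ψ) w = (κ : ℂ) • leviMatrix fsPotential w := by
    rw [show κ • fsPotential + ψ = ψ + κ • (fsPotential : (Fin N → ℂ) → ℝ) from add_comm _ _,
      leviMatrix_add_smul hψ contDiff_fsPotential κ w, leviMatrix_eq_zero_of_notMem_tsupport hw,
      zero_add]
  have hmat : (X : ℂ[X]) • ((κ : ℂ) • leviMatrix fsPotential w).map C +
      (leviMatrix fsPotential w).map C =
        (C (κ : ℂ) * X + 1) • (leviMatrix fsPotential w).map C := by
    refine Matrix.ext fun i j ↦ ?_
    simp only [Matrix.add_apply, Matrix.smul_apply, Matrix.map_apply, smul_eq_mul, map_mul]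
    ring
  rw [hL, hmat, Matrix.det_smul, Fintype.card_fin, ← RingHom.mapMatrix_apply,
    ← RingHom.map_det, Polynomial.coeff_mul_C]
  congr 1
  rw [add_pow]
  simp only [one_pow, mul_one, Polynomial.finsetSum_coeff]
  have hsum : ∀ m ∈ Finset.range (N + 1),
      ((C (κ : ℂ) * X) ^ m * (N.choose m : ℂ[X])).coeff j =
        if j = m then (N.choose m : ℂ) * (κ : ℂ) ^ m else 0 := by
    intro m _
    rw [mul_pow, ← C_pow, ← C_eq_natCast, mul_comm, ← mul_assoc,
      ← map_mul, Polynomial.coeff_C_mul_X_pow]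
  rw [Finset.sum_congr rfl hsum, Finset.sum_ite_eq]
  by_cases hj : j ≤ N
  · rw [if_pos (Finset.mem_range.mpr (Nat.lt_succ_of_le hj))]
  · rw [if_neg (by simpa using hj), Nat.choose_eq_zero_of_lt (not_le.mp hj)]
    simp


/-- The `j`-th pencil coefficient of `κ fs + ψ` is integrable (given the integrability of
`det Levi fs`, i.e. of `(2ᴺ(1+|w|²)^{N+1})⁻¹`). [folklore] -/
theorem integrable_coeff_pencil {κ : ℝ} {ψ : (Fin N → ℂ) → ℝ} (hψ : ContDiff ℝ ∞ ψ)
    (hψc : HasCompactSupport ψ)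
    (hG : Integrable fun w : Fin N → ℂ ↦ (leviMatrix fsPotential w).det)
    (j : ℕ) : Integrable fun w ↦ (pencil(κ • fsPotential + ψ, w)).coeff j := by
  have hu : ContDiff ℝ ∞ (κ • fsPotential + ψ : (Fin N → ℂ) → ℝ) :=
    (contDiff_fsPotential.const_smul κ).add hψ
  have hcontG : Continuous fun w : Fin N → ℂ ↦ (leviMatrix fsPotential w).det :=
    Continuous.matrix_det (continuous_pi fun i ↦ continuous_pi fun j ↦
      continuous_leviMatrix_apply contDiff_fsPotential i j)
  have hdiff : Integrable fun w ↦ (pencil(κ • fsPotential + ψ, w)).coeff j -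
      (N.choose j : ℂ) * (κ : ℂ) ^ j * (leviMatrix fsPotential w).det := by
    apply Continuous.integrable_of_hasCompactSupport
    · exact (continuous_coeff_pencil hu j).sub (continuous_const.mul hcontG)
    · exact HasCompactSupport.of_support_subset_isCompact hψc fun w hw ↦ by_contra fun h ↦ hw
        (by simp only [coeff_pencil_of_notMem_tsupport hψ h, sub_self])
  have key : (fun w ↦ (pencil(κ • fsPotential + ψ, w)).coeff j) =
      (fun w ↦ (pencil(κ • fsPotential + ψ, w)).coeff j -
        (N.choose j : ℂ) * (κ : ℂ) ^ j * (leviMatrix fsPotential w).det) +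
      fun w ↦ (N.choose j : ℂ) * (κ : ℂ) ^ j * (leviMatrix fsPotential w).det := by
    funext w; simp
  rw [key]
  exact hdiff.add (hG.const_mul ((N.choose j : ℂ) * (κ : ℂ) ^ j))

/-- **The pencil value integral**: `∫ det(Levi(κ fs + ψ) + t Levi fs) = (κ + t)ᴺ ∫ det Levi fs`
(perturbation invariance `integral_det_leviMatrix_add_sub` applied to `(κ + t) fs`). [folklore] -/
theorem integral_det_pencil_value {κ t : ℝ} {ψ : (Fin N → ℂ) → ℝ} (hψ : ContDiff ℝ ∞ ψ)
    (hψc : HasCompactSupport ψ)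
    (hG : Integrable fun w : Fin N → ℂ ↦ (leviMatrix fsPotential w).det) :
    ∫ w, (leviMatrix (κ • fsPotential + ψ) w + (t : ℂ) • leviMatrix fsPotential w).det =
      ((κ + t : ℝ) : ℂ) ^ N * ∫ w : Fin N → ℂ, (leviMatrix fsPotential w).det := by
  have hfs : ContDiff ℝ ∞ (fsPotential : (Fin N → ℂ) → ℝ) := contDiff_fsPotential
  have hv : ContDiff ℝ ∞ ((κ + t) • fsPotential : (Fin N → ℂ) → ℝ) := hfs.const_smul (κ + t)
  -- the pencil matrix is the Levi matrix of `(κ + t) fs + ψ`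
  have hmat : ∀ w, leviMatrix (κ • fsPotential + ψ) w + (t : ℂ) • leviMatrix fsPotential w =
      leviMatrix ((κ + t) • fsPotential + ψ) w := by
    intro w
    rw [show κ • fsPotential + ψ = ψ + κ • (fsPotential : (Fin N → ℂ) → ℝ) from add_comm _ _,
      show (κ + t) • fsPotential + ψ = ψ + (κ + t) • (fsPotential : (Fin N → ℂ) → ℝ) from
        add_comm _ _, leviMatrix_add_smul hψ hfs, leviMatrix_add_smul hψ hfs]
    push_cast
    rw [add_smul, add_assoc]
  have hmat' : ∀ w, leviMatrix ((κ + t) • fsPotential + ψ) w =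
      leviMatrix ((κ + t) • fsPotential) w + ((1 : ℝ) : ℂ) • leviMatrix ψ w := by
    intro w
    rw [← leviMatrix_add_smul hv hψ 1 w, one_smul]
  have hscal : ∀ w : Fin N → ℂ, (leviMatrix ((κ + t) • fsPotential) w).det =
      ((κ + t : ℝ) : ℂ) ^ N * (leviMatrix fsPotential w).det := by
    intro w
    rw [leviMatrix_const_smul hfs, Matrix.det_smul, Fintype.card_fin]
  -- invariance and integrability
  have hinv := integral_det_leviMatrix_add_sub ((κ + t) • fsPotential) ψ hv hψ hψc
  have hint1 : Integrable fun w ↦ (leviMatrix ((κ + t) • fsPotential + ψ) w).det -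
      (leviMatrix ((κ + t) • fsPotential) w).det := by
    have := integrable_pencil hv hψ hψc 1
    simp only [← hmat'] at this
    exact this
  have hint2 : Integrable fun w : Fin N → ℂ ↦ (leviMatrix ((κ + t) • fsPotential) w).det := by
    simp only [hscal]
    exact hG.const_mul _
  simp only [hmat]
  calc ∫ w, (leviMatrix ((κ + t) • fsPotential + ψ) w).det
      = ∫ w, ((leviMatrix ((κ + t) • fsPotential + ψ) w).det -
          (leviMatrix ((κ + t) • fsPotential) w).det) +
            (leviMatrix ((κ + t) • fsPotential) w).det := by simp
    _ = 0 + ∫ w, (leviMatrix ((κ + t) • fsPotential) w).det := by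
        rw [integral_add hint1 hint2, hinv]
    _ = ((κ + t : ℝ) : ℂ) ^ N * ∫ w : Fin N → ℂ, (leviMatrix fsPotential w).det := by
        rw [zero_add]
        simp only [hscal]
        exact integral_const_mul _ _

/-- **All orders from the top degree** (the `t`-trick): for `j ≤ N`,
`∫ [sʲ] det(s Levi(κ fs + ψ) + Levi fs) dλ = C(N,j) κʲ ∫ det Levi fs dλ` — the two sides, paired
with `t^{N-j}` and summed over `j`, agree for every `t ≠ 0` (`det_add_smul_eq_sum_coeff`,
`integral_det_pencil_value` and the binomial formula), hence coefficientwise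
(`eq_of_sum_mul_pow_eq` at `t = 1, …, N + 1`). [folklore] -/
theorem integral_coeff_pencil {κ : ℝ} {ψ : (Fin N → ℂ) → ℝ} (hψ : ContDiff ℝ ∞ ψ)
    (hψc : HasCompactSupport ψ)
    (hG : Integrable fun w : Fin N → ℂ ↦ (leviMatrix fsPotential w).det)
    {j : ℕ} (hj : j ≤ N) :
    ∫ w, (pencil(κ • fsPotential + ψ, w)).coeff j =
      (N.choose j : ℂ) * (κ : ℂ) ^ j * ∫ w : Fin N → ℂ, (leviMatrix fsPotential w).det := by
  set m : ℂ := ∫ w : Fin N → ℂ, (leviMatrix fsPotential w).det with hm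
  refine eq_of_sum_mul_pow_eq (ι := Fin (N + 1)) (fun i ↦ ((i : ℕ) + 1 : ℂ)) ?_ (by simp)
    (fun j ↦ ∫ w, (pencil(κ • fsPotential + ψ, w)).coeff j)
    (fun j ↦ (N.choose j : ℂ) * (κ : ℂ) ^ j * m) ?_ hj
  · intro a b hab
    have : ((a : ℕ) : ℂ) = ((b : ℕ) : ℂ) := by simpa using hab
    exact Fin.ext (by exact_mod_cast this)
  intro i
  set t : ℝ := (i : ℕ) + 1 with ht
  have htc : ((t : ℝ) : ℂ) = ((i : ℕ) + 1 : ℂ) := by rw [ht]; push_cast; ring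
  have ht0 : ((t : ℝ) : ℂ) ≠ 0 := by
    rw [htc]; exact Nat.cast_add_one_ne_zero (i : ℕ)
  rw [← htc]
  -- left-hand side: integrate the pointwise expansion of `det (Levi u + t Levi fs)`
  have hint := integrable_coeff_pencil (κ := κ) hψ hψc hG
  have lhs : ∑ j ∈ Finset.range (N + 1),
      (∫ w, (pencil(κ • fsPotential + ψ, w)).coeff j) * ((t : ℝ) : ℂ) ^ (N - j) =
        ∫ w, (leviMatrix (κ • fsPotential + ψ) w +
          ((t : ℝ) : ℂ) • leviMatrix fsPotential w).det := by
    simp only [det_add_smul_eq_sum_coeff _ _ ht0]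
    rw [integral_finsetSum _ fun j _ ↦ (hint j).mul_const _]
    refine Finset.sum_congr rfl fun j _ ↦ ?_
    exact (integral_mul_const _ _).symm
  rw [lhs, integral_det_pencil_value hψ hψc hG, ← hm]
  push_cast
  rw [add_pow, Finset.sum_mul]
  refine Finset.sum_congr rfl fun j _ ↦ ?_
  ring

end AllOrders


section Final

variable {N : ℕ}

/-- `det Levi fs` is integrable on `ℂᴺ` (it is `(2ᴺ (1+|w|²)^{N+1})⁻¹`, dominated by the finite
Fubini–Study volume integral `lintegral_inv_pow_add_sum_norm_sq`). [folklore] -/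
theorem integrable_det_leviMatrix_fsPotential :
    Integrable fun w : Fin N → ℂ ↦ (leviMatrix fsPotential w).det := by
  have hf : ∀ w : Fin N → ℂ, (leviMatrix fsPotential w).det =
      (((((2 : ℝ) ^ N * (1 + ∑ p, ‖w p‖ ^ 2) ^ (N + 1))⁻¹ : ℝ)) : ℂ) := det_leviMatrix_fsPotential
  simp_rw [hf]
  refine Integrable.ofReal ?_
  have hcont : Continuous fun w : Fin N → ℂ ↦ ((2 : ℝ) ^ N * (1 + ∑ p, ‖w p‖ ^ 2) ^ (N + 1))⁻¹ :=
    Continuous.inv₀ (by fun_prop) fun w ↦ by positivity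
  refine ⟨hcont.aestronglyMeasurable, ?_⟩
  rw [hasFiniteIntegral_iff_ofReal (Eventually.of_forall fun w ↦ by
    show (0 : ℝ) ≤ ((2 : ℝ) ^ N * (1 + ∑ p, ‖w p‖ ^ 2) ^ (N + 1))⁻¹
    positivity)]
  have key := lintegral_inv_pow_add_sum_norm_sq N 0 one_pos
  calc ∫⁻ w : Fin N → ℂ, ENNReal.ofReal (((2 : ℝ) ^ N * (1 + ∑ p, ‖w p‖ ^ 2) ^ (N + 1))⁻¹)
      ≤ ∫⁻ w : Fin N → ℂ, ENNReal.ofReal (((1 + ∑ p, ‖w p‖ ^ 2) ^ (N + 0 + 1))⁻¹) := by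
        refine lintegral_mono fun w ↦ ENNReal.ofReal_le_ofReal ?_
        rw [add_zero]
        apply inv_anti₀ (by positivity)
        have h1 : (1 : ℝ) ≤ 2 ^ N := one_le_pow₀ (by norm_num)
        have h2 : 0 ≤ (1 + ∑ p, ‖w p‖ ^ 2) ^ (N + 1) := by positivity
        nlinarith
    _ < ⊤ := by rw [key]; exact ENNReal.ofReal_lt_top

/-- `∫_{ℂᴺ} (dd^c fs)ᴺ = 1` as a Bochner integral (from `lintegral_heightDensity_fsPotential`).
[folklore] -/
theorem integral_heightDensity_fsPotential :
    ∫ w : Fin N → ℂ, heightDensity N fsPotential w = 1 := by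
  have hnn : ∀ w : Fin N → ℂ, 0 ≤ heightDensity N fsPotential w := fun w ↦ by
    rw [heightDensity_fsPotential]
    exact div_nonneg (Nat.cast_nonneg _) (by positivity)
  have hcont : Continuous fun w : Fin N → ℂ ↦ heightDensity N fsPotential w := by
    have : (fun w : Fin N → ℂ ↦ heightDensity N fsPotential w) = fun w ↦
        (N.factorial : ℝ) / (Real.pi ^ N * (1 + ∑ r, ‖w r‖ ^ 2) ^ (N + 1)) :=
      funext heightDensity_fsPotential
    rw [this]
    exact continuous_const.div (by fun_prop) fun w ↦ by positivity
  rw [integral_eq_lintegral_of_nonneg_ae (Eventually.of_forall hnn) hcont.aestronglyMeasurable,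
    lintegral_heightDensity_fsPotential, ENNReal.toReal_one]

/-- `N! (2/π)ᴺ Re ∫ det Levi fs = 1`. [folklore] -/
theorem factorial_mul_re_integral_det_leviMatrix_fsPotential :
    (N.factorial : ℝ) * (2 / Real.pi) ^ N *
      (∫ w : Fin N → ℂ, (leviMatrix fsPotential w).det).re = 1 := by
  have h := integral_heightDensity_fsPotential (N := N)
  simp only [heightDensity_self_eq] at h
  have hre := integral_re (integrable_det_leviMatrix_fsPotential (N := N))
  simp only [RCLike.re_to_complex] at hre
  rw [integral_const_mul, hre] at h
  exact h

/-- **The total Monge–Ampère masses of all orders of a compactly supported smooth perturbation of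
`κ · fs`**: for `ψ : ℂᴺ → ℝ` smooth with compact support, `κ ∈ ℝ` and `j ≤ N`, the density
`heightDensity j (κ fs + ψ)` of `(dd^c(κ fs + ψ))ʲ ∧ ω_FS^{N-j}` is integrable on the chart `ℂᴺ`
and `∫ heightDensity j (κ fs + ψ) dλ = κʲ` (`= {κ ω}ʲ · {ω}^{N-j}`): the `t`-trick
(`integral_coeff_pencil`) on top of the perturbation invariance of the top-degree mass and
`∫ ω_FS^N = 1`. [folklore] -/
theorem integral_heightDensity_smul_fsPotential_add {κ : ℝ} {ψ : (Fin N → ℂ) → ℝ}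
    (hψ : ContDiff ℝ ∞ ψ) (hψc : HasCompactSupport ψ) {j : ℕ} (hj : j ≤ N) :
    Integrable (fun w ↦ heightDensity j (κ • fsPotential + ψ) w) ∧
      ∫ w, heightDensity j (κ • fsPotential + ψ) w = κ ^ j := by
  have hG := integrable_det_leviMatrix_fsPotential (N := N)
  have hcoeff := integrable_coeff_pencil (κ := κ) hψ hψc hG j
  set Kj : ℝ := (N.factorial : ℝ) * (2 / Real.pi) ^ N / (N.choose j : ℝ) with hKj
  have hdens : (fun w ↦ heightDensity j (κ • fsPotential + ψ) w) =
      fun w ↦ Kj * ((pencil(κ • fsPotential + ψ, w)).coeff j).re := rfl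
  refine ⟨?_, ?_⟩
  · rw [hdens]
    exact hcoeff.re.const_mul Kj
  · have hre' := integral_re hcoeff
    simp only [RCLike.re_to_complex] at hre'
    rw [hdens, integral_const_mul, hre', integral_coeff_pencil hψ hψc hG hj]
    have hre : ((N.choose j : ℂ) * (κ : ℂ) ^ j *
        ∫ w : Fin N → ℂ, (leviMatrix fsPotential w).det).re =
          (N.choose j : ℝ) * κ ^ j * (∫ w : Fin N → ℂ, (leviMatrix fsPotential w).det).re := by
      rw [show (N.choose j : ℂ) * (κ : ℂ) ^ j = (((N.choose j : ℝ) * κ ^ j : ℝ) : ℂ) by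
        push_cast; ring,
        Complex.re_ofReal_mul]
    rw [hre]
    have hch : (N.choose j : ℝ) ≠ 0 := by exact_mod_cast (Nat.choose_pos hj).ne'
    have hm := factorial_mul_re_integral_det_leviMatrix_fsPotential (N := N)
    calc Kj * ((N.choose j : ℝ) * κ ^ j * (∫ w : Fin N → ℂ, (leviMatrix fsPotential w).det).re)
        = ((N.factorial : ℝ) * (2 / Real.pi) ^ N *
            (∫ w : Fin N → ℂ, (leviMatrix fsPotential w).det).re) * κ ^ j := by
          rw [hKj]; field_simp
      _ = κ ^ j := by rw [hm, one_mul]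

/-- Adding a constant does not change the densities. [folklore] -/
theorem heightDensity_add_const {u : (Fin N → ℂ) → ℝ} (hu : ContDiff ℝ ∞ u) (a : ℝ) (j : ℕ)
    (w : Fin N → ℂ) : heightDensity j (fun w ↦ u w + a) w = heightDensity j u w := by
  simp only [heightDensity, leviMatrix_add_const hu]

end Final

end Literature.Analysis.Pluripotential

end
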